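import Mathlib
import Summits.Ventures.PercRepro2.Defs
import Summits.Ventures.PercRepro2.Graph
import Summits.Ventures.PercRepro2.OneColourSwitch
import Summits.Ventures.PercRepro2.RegionHubSign
import Summits.Ventures.PercRepro2.SideSwitch
import Summits.Ventures.PercRepro2.SideSwitchFibre
import Summits.Ventures.PercRepro2.SideSwitchClosed
import Summits.Ventures.PercRepro2.SideSwitchComps
import Summits.Ventures.PercRepro2.M9NoPocketDefs
import Summits.Ventures.PercRepro2.M9NoPocketWorld
import Summits.Ventures.PercRepro2.M9NoPocketWorldD
import Summits.Ventures.PercRepro2.M9NoPocketFibre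
import Summits.Ventures.PercRepro2.M9GeneralDSplit
import Summits.Ventures.PercRepro2.M9GeneralDHD
import Summits.Ventures.PercRepro2.M9PocketUnitFibre
import Summits.Ventures.PercRepro2.M9PocketUnitFibreSum
import Summits.Ventures.PercRepro2.M9PocketUnitKonly
import Summits.Ventures.PercRepro2.M9PocketHDTheorem
import Summits.Ventures.PercRepro2.M9PocketProdPoint
import Summits.Ventures.PercRepro2.M9PocketProdWorlds
import Summits.Ventures.PercRepro2.M9PocketProdMono
import Summits.Ventures.PercRepro2.M9PocketProdSum
import Summits.Ventures.PercRepro2.M9PocketProdSkel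
import Summits.Ventures.PercRepro2.M9PocketProdFam
import Summits.Ventures.PercRepro2.M9PocketProdPartition
import Summits.Ventures.PercRepro2.M9PocketProdWsideFam

/-!
# The single-`d` sign sum with free non-linking blocks (blind cell PercRepro2, p3 g39,
2026-08-29; `proofs/P3-POCKETRK.md` §10 (d)–(e): the free-block extension, assembly)

The `K`-half of the hub–dead-end sum is partitioned by the skeleton map
(`M9PocketProdPartition`): the fibre over a skeleton `ρ` is in bijection with the product fibre
of `ρ` indexed by its switchable blocks and free edges (`prod_index_eq`, `index_prod_iff`,
`wside_block_mem_fam`), on which the sum is non-positive (`sum_prod_fibre_HD_nonpos`) as soon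
as no switchable block is adjacent to both `r` and `s`.  Hence

* `sum_fibre_nonpos_of_bij` — the abstract transfer of a non-positive cube sum along a
  bijection of the fibre with the cube;
* `sum_skel_fibre_nonpos` — the `HD`, `d ∈ K₂` sum over the points with skeleton `ρ` is `≤ 0`;
* `hdK_nonpos_of_noLinking` — the `K`-half of the hub–dead-end sum is `≤ 0`;
* **`dSignSum_nonpos_of_noLinking`** — `dSignSum ≤ 0` for every `T`-free graph (no edge
  inside `{r, s}`, no `d r`, `d s` edge) in which no free block of `G − d` (a component of the
  sided set of a `K`-only skeleton carrying no `d`-edge) is adjacent to both `r` and `s`;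
* **`dSignSum_nonpos_of_sepN`** — the same when the neighbourhood of `d` separates `r` from
  `s` in `G − d` (no `r`–`s` path through non-neighbours of `d`).

This contains `dSignSum_nonpos_of_noFreeBlock` (no free block at all) and covers the class in
which the neighbourhood of `d` separates `r` from `s` in `G − d`.  Own work; std axioms.
-/

namespace Summit.Ventures.PercRepro2

namespace NoPocket

open Finset Classical OneColourSwitch SideSwitch

variable {V : Type*} {E : Type*} {ends : E → Sym2 V} {p q r s d : V}

section Transfer

variable {ι : Type*}

/-- **Transfer along a bijection of a fibre with a cube**: if `φ` maps the cube `T` onto the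
fibre `F` (the `W`-defective points of the fibre being exactly the images of the `W`-defective
cube points, `φ` inverse to `idx` on the fibre and on the cube), a non-positive weighted cube
sum is a non-positive fibre sum. -/
theorem sum_fibre_nonpos_of_bij {F : Finset (Config E)} {T : Finset (Finset ι)}
    {φ : Finset ι → Config E}
    (key : ∑ S ∈ T, (if WDefect ends p q r s d (φ S) then
      sigma ends (φ S) p q * sigma ends (φ S) r s else 0) ≤ 0)
    (idx : Config E → Finset ι) (hT : ∀ S, S ∈ T)
    (hpt : ∀ ω ∈ F, φ (idx ω) = ω) (hidx : ∀ S, idx (φ S) = S)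
    (hW : ∀ ω ∈ F, WDefect ends p q r s d ω)
    (hmem : ∀ S, WDefect ends p q r s d (φ S) → φ S ∈ F) :
    ∑ ω ∈ F, sigma ends ω p q * sigma ends ω r s ≤ 0 := by
  refine le_trans (le_of_eq ?_) key
  rw [← Finset.sum_filter]
  refine Finset.sum_nbij' idx φ ?_ ?_ ?_ ?_ ?_
  · intro ω hω
    rw [Finset.mem_filter]
    refine ⟨hT _, ?_⟩
    simp only [hpt ω hω]
    exact hW ω hω
  · intro S hS
    rw [Finset.mem_filter] at hS
    exact hmem S hS.2
  · intro ω hω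
    exact hpt ω hω
  · intro S _
    exact hidx S
  · intro ω hω
    simp only [hpt ω hω]

end Transfer

section Skel

variable [Fintype V] [DecidableEq V] [Fintype E] [DecidableEq E]

/-- **The `HD`, `d ∈ K₂` sum over the points with skeleton `ρ` is non-positive** when no free
component of the sided set of `ρ` is adjacent to both `r` and `s`: the fibre is the product
fibre of `ρ` indexed by its switchable blocks and free edges. -/
theorem sum_skel_fibre_nonpos (hdr : d ≠ r) (hds : d ≠ s)
    (hrs : within ends ({r, s} : Set V) = ∅) (hT : ∀ e, ends e ≠ s(d, r) ∧ ends e ≠ s(d, s))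
    (hp : p ≠ d) (hq : q ≠ d) {ρ : Config E}
    (hsep : sep2 ends p q r s ρ) (hD : DOne ends r s d ρ) (hK : d ∈ K2 ends r s ρ)
    (hB : ∀ x ∈ M2 (endsD ends d) r s ρ, x = r ∨ x = s)
    (hρR : ∀ e ∉ touches ends (cluster ends ρ d ∪ K2 (endsD ends d) r s ρ ∪
      M2 (endsD ends d) r s ρ), ρ e = false)
    (hnl : ∀ C ∈ comps (endsD ends d) r s ρ, (∀ e y, y ∈ C → ends e ≠ s(d, y)) →
      (∀ e y, y ∈ C → ends e ≠ s(r, y)) ∨ (∀ e y, y ∈ C → ends e ≠ s(s, y))) :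
    ∑ ω ∈ (univ.filter (fun ω : Config E => HD ends p q r s d ω ∧ d ∈ K2 ends r s ω)).filter
        (fun ω => (fun e => if e ∈ touches ends
          (cluster ends (flipTouch (endsD ends d)
              {x : V | x ∈ M2 (endsD ends d) r s ω ∧ x ≠ r ∧ x ≠ s} ω) d ∪
            K2 (endsD ends d) r s (flipTouch (endsD ends d)
              {x : V | x ∈ M2 (endsD ends d) r s ω ∧ x ≠ r ∧ x ≠ s} ω) ∪
            M2 (endsD ends d) r s (flipTouch (endsD ends d)
              {x : V | x ∈ M2 (endsD ends d) r s ω ∧ x ≠ r ∧ x ≠ s} ω)) then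
          flipTouch (endsD ends d) {x : V | x ∈ M2 (endsD ends d) r s ω ∧ x ≠ r ∧ x ≠ s} ω e
          else false) = ρ),
      sigma ends ω p q * sigma ends ω r s ≤ 0 := by
  have hR := mem_R_iff (ends := ends) (r := r) (s := s) (d := d) (ρ := ρ)
  have h𝔉K := fam_subset_K2 (ends := ends) (d := d) hB
  have key := sum_prod_fibre_HD_nonpos (p := p) (q := q) hdr hds hrs hT hsep hD hK hB hR h𝔉K
    fam_notMem_r fam_notMem_s fam_closedIn fam_free fam_pocket fam_disjoint (fam_nl_of hnl)
  refine sum_fibre_nonpos_of_bij key (fun ω => univ.filter (fun i =>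
    (∀ c, i = Sum.inl c →
      (↑c.1 : Set V) ⊆ {x : V | x ∈ M2 (endsD ends d) r s ω ∧ x ≠ r ∧ x ≠ s}) ∧
    ∀ e, i = Sum.inr e → ω e.1 = true)) mem_univ_index ?_ ?_ ?_ ?_
  · intro ω hω
    rw [Finset.mem_filter, Finset.mem_filter] at hω
    obtain ⟨⟨_, hHD⟩, hρω⟩ := hω
    obtain ⟨hsepω, hDω, hKω, hMω, _⟩ := HD_konly_iff.1 hHD
    exact prod_index_eq hdr hds hT hsepω hDω hKω hMω hp hq hρω.symm hR h𝔉K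
      (wside_block_mem_fam hdr hds hT hsepω hDω hKω hMω hρω.symm) _
      (fun i => Finset.mem_filter.trans (and_iff_right (Finset.mem_univ i)))
  · intro S
    ext i
    exact (Finset.mem_filter.trans (and_iff_right (Finset.mem_univ i))).trans
      (index_prod_iff hdr hds hrs hT hsep hB hR h𝔉K fam_notMem_r fam_notMem_s fam_closedIn
        fam_disjoint fam_nonempty S i).symm
  · intro ω hω
    rw [Finset.mem_filter, Finset.mem_filter] at hω
    exact (HD_konly_iff.1 hω.1.2).2.2.2.2
  · intro S hS
    rw [Finset.mem_filter, Finset.mem_filter]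
    refine ⟨⟨Finset.mem_univ _, HD_konly_iff.2 ⟨sep2_prod hdr hds hrs hT hsep hD hK hB hR h𝔉K
      fam_notMem_r fam_notMem_s fam_closedIn fam_free fam_pocket S hp hq,
      DOne_prod hdr hds hrs hT hsep hD hB hR h𝔉K fam_notMem_r fam_notMem_s fam_closedIn
        fam_free fam_pocket S,
      d_mem_K2_prod hdr hds hrs hT hsep hK hB hR h𝔉K fam_notMem_r fam_notMem_s fam_closedIn
        fam_free S,
      d_notMem_M2_prod hdr hds hrs hT hsep hB hR h𝔉K fam_notMem_r fam_notMem_s fam_closedIn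
        fam_free S, hS⟩⟩, ?_⟩
    exact skel_prod_eq hdr hds hrs hT hsep hB hρR hR h𝔉K fam_notMem_r fam_notMem_s fam_closedIn S

/-- **The `K`-half of the hub–dead-end sum is non-positive** when no free block of `G − d` is
adjacent to both `r` and `s`: partition by the skeleton. -/
theorem hdK_nonpos_of_noLinking (hdr : d ≠ r) (hds : d ≠ s)
    (hrs : within ends ({r, s} : Set V) = ∅) (hT : ∀ e, ends e ≠ s(d, r) ∧ ends e ≠ s(d, s))
    (hp : p ≠ d) (hq : q ≠ d)
    (hnl : ∀ ρ : Config E, ∀ C ∈ comps (endsD ends d) r s ρ,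
      (∀ e y, y ∈ C → ends e ≠ s(d, y)) →
      (∀ e y, y ∈ C → ends e ≠ s(r, y)) ∨ (∀ e y, y ∈ C → ends e ≠ s(s, y))) :
    (∑ ω : Config E, if HD ends p q r s d ω ∧ d ∈ K2 ends r s ω then
      sigma ends ω p q * sigma ends ω r s else 0) ≤ 0 := by
  rw [← Finset.sum_filter]
  have hmaps : ∀ ω ∈ univ.filter (fun ω : Config E => HD ends p q r s d ω ∧ d ∈ K2 ends r s ω),
      (fun e => if e ∈ touches ends
          (cluster ends (flipTouch (endsD ends d)
              {x : V | x ∈ M2 (endsD ends d) r s ω ∧ x ≠ r ∧ x ≠ s} ω) d ∪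
            K2 (endsD ends d) r s (flipTouch (endsD ends d)
              {x : V | x ∈ M2 (endsD ends d) r s ω ∧ x ≠ r ∧ x ≠ s} ω) ∪
            M2 (endsD ends d) r s (flipTouch (endsD ends d)
              {x : V | x ∈ M2 (endsD ends d) r s ω ∧ x ≠ r ∧ x ≠ s} ω)) then
          flipTouch (endsD ends d) {x : V | x ∈ M2 (endsD ends d) r s ω ∧ x ≠ r ∧ x ≠ s} ω e
          else false) ∈ univ.filter (fun ρ : Config E =>
        sep2 ends p q r s ρ ∧ DOne ends r s d ρ ∧ d ∈ K2 ends r s ρ ∧ d ∉ M2 ends r s ρ ∧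
          (∀ x ∈ M2 (endsD ends d) r s ρ, x = r ∨ x = s) ∧
          ∀ e ∉ touches ends (cluster ends ρ d ∪ K2 (endsD ends d) r s ρ ∪
            M2 (endsD ends d) r s ρ), ρ e = false) := by
    intro ω hω
    rw [Finset.mem_filter] at hω
    obtain ⟨hsep, hD, hK, hM, _⟩ := HD_konly_iff.1 hω.2
    rw [Finset.mem_filter]
    refine ⟨Finset.mem_univ _, ?_⟩
    obtain ⟨h1, h2, h3, h4, h5, -, h7⟩ := skel_legal hdr hds hrs hT hsep hD hK hM hp hq
    exact ⟨h1, h2, h3, h4, h5, h7⟩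
  rw [← Finset.sum_fiberwise_of_maps_to hmaps]
  refine Finset.sum_nonpos fun ρ hρ => ?_
  rw [Finset.mem_filter] at hρ
  obtain ⟨_, hsep, hD, hK, _, hB, hρR⟩ := hρ
  exact sum_skel_fibre_nonpos hdr hds hrs hT hp hq hsep hD hK hB hρR (hnl ρ)

omit [Fintype V] [DecidableEq V] in
/-- With `p = d` or `q = d` there is no `HD` point with `d ∈ K₂` (`Sep` separates `p`, `q`
from `r`, `s`): the `K`-half of the hub–dead-end sum vanishes. -/
lemma hdK_eq_zero_of_eq (h : p = d ∨ q = d) :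
    (∑ ω : Config E, if HD ends p q r s d ω ∧ d ∈ K2 ends r s ω then
      sigma ends ω p q * sigma ends ω r s else 0) = 0 := by
  refine Finset.sum_eq_zero fun ω _ => ?_
  rw [if_neg]
  rintro ⟨hHD, hK⟩
  obtain ⟨hsep, -, -, -, -⟩ := HD_konly_iff.1 ⟨hHD, hK⟩
  rcases mem_K2_iff.1 hK with hc | hc
  · rcases h with h | h
    · exact hsep.1.1 (h ▸ conn_symm hc)
    · exact hsep.1.2.2.1 (h ▸ conn_symm hc)
  · rcases h with h | h
    · exact hsep.1.2.1 (h ▸ conn_symm hc)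
    · exact hsep.1.2.2.2 (h ▸ conn_symm hc)

/-- **The single-`d` sign sum is non-positive for `T`-free graphs without a linking free
block**: no edge inside `{r, s}`, no edge `d r` or `d s`, and no free block of `G − d` (a
component of the sided set of a `K`-only skeleton carrying no `d`-edge) is adjacent to both
`r` and `s`. -/
theorem dSignSum_nonpos_of_noLinking (hdr : d ≠ r) (hds : d ≠ s)
    (hrs : within ends ({r, s} : Set V) = ∅) (hT : ∀ e, ends e ≠ s(d, r) ∧ ends e ≠ s(d, s))
    (hnl : ∀ ρ : Config E, ∀ C ∈ comps (endsD ends d) r s ρ,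
      (∀ e y, y ∈ C → ends e ≠ s(d, y)) →
      (∀ e y, y ∈ C → ends e ≠ s(r, y)) ∨ (∀ e y, y ∈ C → ends e ≠ s(s, y))) :
    dSignSum ends p q r s d ≤ 0 := by
  refine dSignSum_nonpos_of_hdSum_nonpos hdr.symm hds.symm ?_
  rw [hdSum_eq_two_mul_hdK]
  by_cases h : p = d ∨ q = d
  · rw [hdK_eq_zero_of_eq h]; norm_num
  · rw [not_or] at h
    have := hdK_nonpos_of_noLinking (p := p) (q := q) hdr hds hrs hT h.1 h.2 hnl
    omega

end Skel

section Separation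

/-- A `Y`-path inside a closed set of `chi A` is a `Y`-path of `chi B` for `C ⊆ B`. -/
lemma conn_chi_of_conn_chi_closed {A B C : Set V} {x y : V} (hCB : C ⊆ B)
    (hcl : ∀ a ∈ C, ∀ b, (openGraph ends (chi ends A)).Adj a b → b ∈ C) (hx : x ∈ C)
    (h : Conn ends (chi ends A) x y) : Conn ends (chi ends B) x y := by
  rw [Conn, SimpleGraph.reachable_iff_reflTransGen] at h ⊢
  induction h with
  | refl => exact Relation.ReflTransGen.refl
  | tail hxz hzy ih =>
    rename_i z w
    have hz : z ∈ C := mem_of_conn_of_closed hcl hx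
      (by rw [Conn, SimpleGraph.reachable_iff_reflTransGen]; exact hxz)
    have hw : w ∈ C := hcl z hz w hzy
    refine Relation.ReflTransGen.tail ih ?_
    rw [openGraph_adj] at hzy ⊢
    obtain ⟨hne, e, he, hends⟩ := hzy
    exact ⟨hne, e, chi_eq_true_iff.2 ⟨z, hCB hz, w, hCB hw, hends⟩, hends⟩

variable [Fintype V] [DecidableEq V]

/-- **Separation gives the non-linking hypothesis**: if the neighbourhood of `d` separates `r`
from `s` in `G − d` (no `r`–`s` path of `G − d` through non-neighbours of `d`), then no free
component of a sided set is adjacent to both `r` and `s`. -/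
lemma noLinking_of_sepN (hdr : d ≠ r) (hds : d ≠ s)
    (hT : ∀ e, ends e ≠ s(d, r) ∧ ends e ≠ s(d, s))
    (hsepN : ¬ Conn (endsD ends d) (chi (endsD ends d) {x : V | ∀ e, ends e ≠ s(d, x)}) r s) :
    ∀ ρ : Config E, ∀ C ∈ comps (endsD ends d) r s ρ, (∀ e y, y ∈ C → ends e ≠ s(d, y)) →
      (∀ e y, y ∈ C → ends e ≠ s(r, y)) ∨ (∀ e y, y ∈ C → ends e ≠ s(s, y)) := by
  intro ρ C hC hfree
  by_contra hboth
  rw [not_or] at hboth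
  obtain ⟨h₁, h₂⟩ := hboth
  simp only [not_forall, not_not] at h₁ h₂
  obtain ⟨e₁, y₁, hy₁, he₁⟩ := h₁
  obtain ⟨e₂, y₂, hy₂, he₂⟩ := h₂
  apply hsepN
  -- the vertices of `C` are non-neighbours of `d` different from `d`
  have hCN : (↑C : Set V) ⊆ {x : V | ∀ e, ends e ≠ s(d, x)} :=
    fun y hy e => hfree e y (Finset.mem_coe.1 hy)
  have hCd : ∀ y ∈ C, y ≠ d := by
    intro y hy hyd
    have := mem_A0.1 (subset_A0_of_mem_comps hC hy)
    rw [hyd] at this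
    rcases this.1 with h | h
    · exact not_mem_K2_endsD hdr hds ρ h
    · exact not_mem_M2_endsD hdr hds ρ h
  have hrN : r ∈ {x : V | ∀ e, ends e ≠ s(d, x)} := fun e => (hT e).1
  have hsN : s ∈ {x : V | ∀ e, ends e ≠ s(d, x)} := fun e => (hT e).2
  -- `r ~ y₁` and `y₂ ~ s` through the attaching edges
  have hr1 : Conn (endsD ends d) (chi (endsD ends d) {x : V | ∀ e, ends e ≠ s(d, x)}) r y₁ := by
    have hde : d ∉ ends e₁ := notMem_of_ends_ne he₁ hdr.symm (hCd y₁ hy₁)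
    refine conn_of_openAdj ⟨e₁, chi_eq_true_iff.2 ⟨r, hrN, y₁, hCN (Finset.mem_coe.2 hy₁), ?_⟩, ?_⟩
    · rw [endsD_of_notMem hde, he₁]
    · rw [endsD_of_notMem hde, he₁]
  have hs2 : Conn (endsD ends d) (chi (endsD ends d) {x : V | ∀ e, ends e ≠ s(d, x)}) y₂ s := by
    have hde : d ∉ ends e₂ := notMem_of_ends_ne he₂ hds.symm (hCd y₂ hy₂)
    refine conn_of_openAdj ⟨e₂, chi_eq_true_iff.2 ⟨s, hsN, y₂, hCN (Finset.mem_coe.2 hy₂), ?_⟩, ?_⟩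
    · rw [endsD_of_notMem hde, he₂, Sym2.eq_swap]
    · rw [endsD_of_notMem hde, he₂, Sym2.eq_swap]
  -- `y₁ ~ y₂` inside the component, transferred to the non-neighbours
  have h12 : Conn (endsD ends d) (chi (endsD ends d) {x : V | ∀ e, ends e ≠ s(d, x)}) y₁ y₂ := by
    have hcomp : Conn (endsD ends d) (chi (endsD ends d) (↑(A0 (endsD ends d) r s ρ) : Set V))
        y₁ y₂ := by
      have := eq_compIn_of_mem_comps hC hy₁
      rw [this] at hy₂
      exact mem_compIn.1 hy₂
    refine conn_chi_of_conn_chi_closed hCN ?_ (Finset.mem_coe.2 hy₁) hcomp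
    intro a ha b hab
    obtain ⟨_, e, he, hends⟩ := openGraph_adj.1 hab
    obtain ⟨u, hu, v, hv, huv⟩ := chi_eq_true_iff.1 he
    have hbA : b ∈ A0 (endsD ends d) r s ρ := by
      rw [hends, Sym2.eq_iff] at huv
      rcases huv with ⟨_, h2⟩ | ⟨_, h2⟩
      · rw [h2]; exact Finset.mem_coe.1 hv
      · rw [h2]; exact Finset.mem_coe.1 hu
    exact closedIn_of_mem_comps hC e a b hends ha (by rw [sided_eq_coe_A0]; exact hbA)
  exact conn_trans hr1 (conn_trans h12 hs2)

/-- **The single-`d` sign sum is non-positive when the neighbourhood of `d` separates `r`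
from `s` in `G − d`** (the headline class of the pocket theorem): `T`-free (no edge inside
`{r, s}`, no `d r`, `d s` edge) and no `r`–`s` path of `G − d` avoids the neighbours of `d`;
`p`, `q` arbitrary (for `p = d` or `q = d` the `K`-half is empty). -/
theorem dSignSum_nonpos_of_sepN [Fintype E] [DecidableEq E] (hdr : d ≠ r) (hds : d ≠ s)
    (hrs : within ends ({r, s} : Set V) = ∅) (hT : ∀ e, ends e ≠ s(d, r) ∧ ends e ≠ s(d, s))
    (hsepN : ¬ Conn (endsD ends d) (chi (endsD ends d) {x : V | ∀ e, ends e ≠ s(d, x)}) r s) :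
    dSignSum ends p q r s d ≤ 0 :=
  dSignSum_nonpos_of_noLinking hdr hds hrs hT (noLinking_of_sepN hdr hds hT hsepN)

end Separation

end NoPocket

end Summit.Ventures.PercRepro2
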